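import Summits.QuantumFields.YangMills.Theorems.BalabanUVNodesN09FlatSectorUniqueness
import Literature.MathematicalPhysics.QuantumFieldTheory.Balaban1983to89.Node00.SmallFieldChiOfRecord

/-!
# BalabanUVNodes ∕ N09 — THE FLAT SECTOR OF (0.21) AT THE T⁴ RECORD, FILE 2: its data are LEVEL-`k` FLAT (hence in every small-field domain
# `domAltOfRecord ν K k` the N09 doors quantify over) and contain EVERY PURE GAUGE `1^{v}` of level `k`; [B11] Thm 1's clauses there BY NAME

TRACK A (YM-PLAN §2b, node N09 = [B12]), WIDTH SEAT `pub-ymgap-dag-n09-w1` (g3; HUMAN RULING D-0149, director-ym №197), FILE 2 over this seat's FILE 1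
`…N09FlatSectorUniqueness`.  Key of record: K1⁷ `StabilityBAtRecordR13SepCoPH` = stmt-QuantumFields-20542 (`--supports`, count-neutral helper).  THEOREMS ONLY, def-free,
sorry-free, standard axioms.  [I] = [Balaban1987RG1], [B11] = [Balaban1985Variational].

WHY.  FILE 1 proved [B11] Thm 1's clauses (N09's displayed `h07sol ∕ h07res ∕ h07uniq`, `hreg8`) at every datum `V = M^k(U_f)`, `U_f` plaquette-flat.  The doors quantify
`∀ V ∈ domAltOfRecord θ.ν P.K k` ([I] p. 259: `|V(∂p) − 1| < ε₀`).  THIS FILE places the flat sector INSIDE that domain and populates it: (§1) a flat-sector datum is itself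
plaquette-flat at level `k` (the `k`-fold average of record of a holonomy-flat field is its straight-segment field, ym3-torus `Prop7FlatHolonomy.flat_straightIter`, and
holonomy-flat ⇒ plaquette-flat, `Prop7FlatRigidity.plaqHol_eq_one_of_holFlat`), hence lies in `domAltOfRecord ν K k` for every numerics `ν` with `0 < ν.ε₀`; (§2) every
PURE GAUGE `1^{v}`, `v : T^{(k)} → SU(N)`, is a flat-sector datum (`k ≤ m + K`: `v` extends to the finest torus through a left inverse of the injective centre embedding
`embIter k`, and `M^k(1^{u}) = (M^k 1)^{u∘ι_k} = 1^{v}` by the covariance of the average of record, `B12CriticalPoint23.iter_gaugeAct`); (§3) so [B11] Thm 1's clauses and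
`hreg8` hold BY NAME at every pure-gauge datum of every `domAlt_k` — `uniqueUkOrbit_gaugeAct_one`, `h11_gaugeAct_one`, `Uk_gaugeAct_one_mem_bgReg`, `huniq_gaugeAct_one`.

HONEST FRAMING: count-neutral kernel bookkeeping BY NAME (FILE 1, ym3-torus's generic flat toolkit, NODE 00's definitions); NOTHING of Bałaban's analysis asserted or used;
[B11] Thm 1 in its regime untouched; NO carrier re-pointed; N09 NOT discharged; K0⁷ ∕ K1⁷ NOT closed; counts unmoved (typed 28∕28 · discharged 5∕27); one finite four-torus
programme at fixed `ε = L^{−K}` — R4 closes the conditional rung `BalabanLadder.UV` only; NOT ℝ⁴ ∕ OS ∕ mass gap; the Yang–Mills mass gap (Clay) is NOT proved by any of this.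
-/

noncomputable section

namespace Summit.QuantumFields.YangMills.BalabanUVNodes.N09FlatSectorData

open scoped Matrix.Norms.L2Operator
open Literature.MathematicalPhysics.QuantumFieldTheory.Balaban1983to89
open Literature.MathematicalPhysics.QuantumFieldTheory.Balaban1983to89.T4Continuum
open Literature.MathematicalPhysics.QuantumFieldTheory.Balaban1983to89.Node00
open Literature.MathematicalPhysics.QuantumFieldTheory.Balaban1983to89.B12GaugeOrbits021 (OrbitRel IsResidual)
open Literature.MathematicalPhysics.QuantumFieldTheory.Balaban1983to89.B15DeterminingSets (embIter)
open Summit.QuantumFields.YangMills.Theorems.Prop7FlatHolonomy (flat_straightIter)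
open Summit.QuantumFields.YangMills.Theorems.Prop7FlatRigidity (plaqHol_eq_one_of_holFlat)
open Summit.QuantumFields.YangMills.BalabanUVNodes.N07Prop8StepFlatWitness (iter_avOfRecord_one)
open Summit.QuantumFields.YangMills.BalabanUVNodes.N09FlatSectorUniqueness
open GaugeField (gaugeAct plaqHol)

variable {F : T4Family} {N : ℕ} [NeZero N]

/-! ## §1. Flat-sector data are level-`k` flat, hence in every `domAltOfRecord ν K k` -/

/-- **A FLAT-SECTOR DATUM IS PLAQUETTE-FLAT AT ITS OWN LEVEL**: `M^k(U_f)` is the straight-`L^k`-segment field of the holonomy-flat `U_f`, which is holonomy-flat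
at level `k`, hence plaquette-flat. [cite: Balaban1987RG1, (0.11) p.253; Balaban1985Averaging, (9) p.19] -/
theorem flat_iter_of_flat {K : ℕ} {U : GaugeField (F.P K) 0 (SU N)} (hU : ∀ p, plaqHol U p = 1) (k : ℕ) :
    ∀ p : Plaq (F.P K) k, plaqHol (Averaging.iter (avOfRecord F N K) k U) p = 1 := by
  rw [iter_avOfRecord_eq_straight_of_flat hU k]
  exact plaqHol_eq_one_of_holFlat _ (flat_straightIter U (holFlat_of_flat hU) k)

/-- Hence a flat-sector datum lies in the small-field domain `domAltOfRecord ν K k` of EVERY numerics `ν` with `0 < ν.ε₀` — the domain the N09 doors quantify over.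
[cite: Balaban1987RG1, p.259 and (1.2) p.260] -/
theorem iter_mem_domAltOfRecord_of_flat {K : ℕ} {U : GaugeField (F.P K) 0 (SU N)} (hU : ∀ p, plaqHol U p = 1) (ν : Stage7Numerics) (hε₀ : 0 < ν.ε₀)
    (k : ℕ) : Averaging.iter (avOfRecord F N K) k U ∈ domAltOfRecord F N ν K k := by
  rw [mem_domAltOfRecord_iff]
  intro p
  rw [flat_iter_of_flat hU k p, GaugeGroup.dist1_one]
  exact hε₀

/-- The flat sector of level `k` is contained in `domAltOfRecord ν K k` (`0 < ν.ε₀`). [cite: Balaban1987RG1, p.259 (bookkeeping)] -/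
theorem flatSector_subset_domAltOfRecord (K k : ℕ) (ν : Stage7Numerics) (hε₀ : 0 < ν.ε₀) :
    {V | ∃ U : GaugeField (F.P K) 0 (SU N), (∀ p, plaqHol U p = 1) ∧ Averaging.iter (avOfRecord F N K) k U = V} ⊆ domAltOfRecord F N ν K k := by
  rintro V ⟨U, hU, rfl⟩
  exact iter_mem_domAltOfRecord_of_flat hU ν hε₀ k

/-! ## §2. Every pure gauge of level `k` is a flat-sector datum -/

/-- A pure gauge of the trivial field is plaquette-flat (`u(x) u(x)⁻¹ = 1` around the plaquette). [cite: Balaban1985Averaging, (8)–(9) p.19] -/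
theorem flat_gaugeAct_one {P : Params} {j : ℕ} (u : GaugeTransf P j (SU N)) : ∀ p : Plaq P j, plaqHol (gaugeAct u (1 : GaugeField P j (SU N))) p = 1 := by
  intro p
  simp only [GaugeField.plaqHol, GaugeField.gaugeAct, PBond.tgt, Site.shift_comm p.src p.ν p.μ,
    show ∀ b : PBond P j, (1 : GaugeField P j (SU N)) b = 1 from fun _ => rfl, mul_one]
  group

/-- The centre embedding `emb : T^{(j+1)} → T^{(j)}` is injective in the standing range (`blockOf ∘ emb = id`, `TorusGeometry.blockOf_emb`). [cite: Balaban1987RG1, (0.1) p.252 (bookkeeping)] -/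
theorem emb_injective {P : Params} {j : ℕ} (hj : j + 1 ≤ P.m + P.K) : Function.Injective (emb : Site P (j + 1) → Site P j) :=
  fun y y' h => by rw [← Site.blockOf_emb hj y, ← Site.blockOf_emb hj y', h]

/-- The iterated centre embedding `embIter k : T^{(k)} → T^{(0)}` is injective for `k ≤ m + K`. [cite: Balaban1987RG1, (0.1) p.251 (bookkeeping)] -/
theorem embIter_injective {P : Params} : ∀ {k : ℕ}, k ≤ P.m + P.K → Function.Injective (embIter (P := P) k)
  | 0, _ => fun _ _ h => h
  | _ + 1, hk => fun _ _ h => emb_injective hk (embIter_injective (Nat.le_of_succ_le hk) h)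

/-- **EVERY PURE GAUGE `1^{v}` OF LEVEL `k ≤ m + K` IS A FLAT-SECTOR DATUM**: extend `v` to the finest torus through a left inverse of `embIter k`; the pure gauge
`1^{u}` is plaquette-flat and `M^k(1^{u}) = (M^k 1)^{u ∘ ι_k} = 1^{v}` (covariance of the average of record). [cite: Balaban1985Averaging, (11) p.19; Balaban1987RG1, (0.11) p.253] -/
theorem exists_flat_iter_eq_gaugeAct_one {K k : ℕ} (hk : k ≤ (F.P K).m + (F.P K).K) (v : GaugeTransf (F.P K) k (SU N)) :
    ∃ U : GaugeField (F.P K) 0 (SU N), (∀ p, plaqHol U p = 1) ∧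
      Averaging.iter (avOfRecord F N K) k U = gaugeAct v (1 : GaugeField (F.P K) k (SU N)) := by
  classical
  set u : GaugeTransf (F.P K) 0 (SU N) := fun x => v (Function.invFun (embIter (P := F.P K) k) x) with hu
  refine ⟨gaugeAct u 1, flat_gaugeAct_one u, ?_⟩
  rw [B12CriticalPoint23.iter_gaugeAct (avOfRecord F N K) k hk u 1, iter_avOfRecord_one F N K k]
  have hinv : ∀ y : Site (F.P K) k, u (embIter k y) = v y := fun y => by
    rw [hu]
    exact congrArg v (Function.leftInverse_invFun (embIter_injective hk) y)
  simp only [hinv]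

/-! ## §3. [B11] Thm 1's clauses at every pure-gauge datum, BY NAME from FILE 1 -/

/-- ★ **[B11] THM 1's UNIQUENESS CLAUSE AT EVERY PURE GAUGE `1^{v}`**, every level `k ≤ m + K`, every radius. [cite: Balaban1985Variational, Thm 1 p.279] -/
theorem uniqueUkOrbit_gaugeAct_one {K k : ℕ} (hk : k ≤ (F.P K).m + (F.P K).K) (ε : ℝ) (v : GaugeTransf (F.P K) k (SU N)) :
    UniqueUkOrbit F N K k ε (gaugeAct v (1 : GaugeField (F.P K) k (SU N))) := by
  obtain ⟨U, hU, hV⟩ := exists_flat_iter_eq_gaugeAct_one (F := F) (N := N) hk v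
  rw [← hV]
  exact uniqueUkOrbit_of_flat_iter hk ε hU

/-- [B11] (1.1), both clauses, at every pure gauge `1^{v}` (`ε > 0`, `k ≤ m + K`) — the door's `h07sol` at pure-gauge data. [cite: Balaban1985Variational, Thm 1 p.279] -/
theorem h11_gaugeAct_one {K k : ℕ} (hk : k ≤ (F.P K).m + (F.P K).K) {ε : ℝ} (hε : 0 < ε) (v : GaugeTransf (F.P K) k (SU N)) :
    UkExists F N K k ε (gaugeAct v (1 : GaugeField (F.P K) k (SU N))) ∧ UniqueUkOrbit F N K k ε (gaugeAct v (1 : GaugeField (F.P K) k (SU N))) := by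
  obtain ⟨U, hU, hV⟩ := exists_flat_iter_eq_gaugeAct_one (F := F) (N := N) hk v
  rw [← hV]
  exact h11_of_flat_iter hk hε hU

/-- `U_k(1^{v})` is plaquette-flat (`ε > 0`, `k ≤ m + K`). [cite: Balaban1987RG1, (0.21) p.256] -/
theorem flat_Uk_gaugeAct_one {K k : ℕ} (hk : k ≤ (F.P K).m + (F.P K).K) {ε : ℝ} (hε : 0 < ε) (v : GaugeTransf (F.P K) k (SU N)) :
    ∀ p, plaqHol (Uk F N K k ε (gaugeAct v (1 : GaugeField (F.P K) k (SU N)))) p = 1 := by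
  obtain ⟨U, hU, hV⟩ := exists_flat_iter_eq_gaugeAct_one (F := F) (N := N) hk v
  rw [← hV]
  exact flat_Uk_of_flat_iter k hε hU

/-- `hreg8` at every pure gauge, for every pair of radii and levels: `U_k … ε (1^{v}) ∈ bgReg … k′ ε′` (`ε, ε′ > 0`). [cite: Balaban1985Variational, Thm 1 (8)–(10) p.279] -/
theorem Uk_gaugeAct_one_mem_bgReg {K k : ℕ} (hk : k ≤ (F.P K).m + (F.P K).K) {ε : ℝ} (hε : 0 < ε) (v : GaugeTransf (F.P K) k (SU N))
    (k' : ℕ) {ε' : ℝ} (hε' : 0 < ε') : Uk F N K k ε (gaugeAct v (1 : GaugeField (F.P K) k (SU N))) ∈ bgReg F N K k' ε' :=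
  mem_bgReg_of_flat (flat_Uk_gaugeAct_one hk hε v) k' hε'

/-- `h07uniq` at every pure gauge: uniqueness at the averaged minimisers `M^{j+1}(U_k (1^{v}))`, `j < k ≤ m + K`, `ε > 0`. [cite: Balaban1985Variational, Thm 1 p.279] -/
theorem huniq_gaugeAct_one {K k : ℕ} (hk : k ≤ (F.P K).m + (F.P K).K) {ε : ℝ} (hε : 0 < ε) (v : GaugeTransf (F.P K) k (SU N)) :
    ∀ j < k, UniqueUkOrbit F N K (j + 1) ε
      (Averaging.iter (avOfRecord F N K) (j + 1) (Uk F N K k ε (gaugeAct v (1 : GaugeField (F.P K) k (SU N))))) := by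
  obtain ⟨U, hU, hV⟩ := exists_flat_iter_eq_gaugeAct_one (F := F) (N := N) hk v
  rw [← hV]
  exact huniq_of_flat_iter hk hε hU

/-- `h07res` on the set of pure gauges of level `k ≤ m + K` (`ε > 0`). [cite: Balaban1985Variational, Thm 1 (8)–(10) p.279] -/
theorem hRestrict_gaugeAct_one {K k : ℕ} (hk : k ≤ (F.P K).m + (F.P K).K) {ε : ℝ} (hε : 0 < ε) :
    HRestrict F N ε K k {V | ∃ v : GaugeTransf (F.P K) k (SU N), gaugeAct v 1 = V} := by
  rintro V ⟨v, rfl⟩ j hj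
  obtain ⟨U, hU, hV⟩ := exists_flat_iter_eq_gaugeAct_one (F := F) (N := N) hk v
  exact hRestrict_of_flat_iter (F := F) (N := N) k hε _ ⟨U, hU, hV⟩ j hj

/-- Pure gauges of level `k` lie in `domAltOfRecord ν K k` (`0 < ν.ε₀`): the door's domain contains all of them. [cite: Balaban1987RG1, p.259 (bookkeeping)] -/
theorem gaugeAct_one_mem_domAltOfRecord {K k : ℕ} (v : GaugeTransf (F.P K) k (SU N)) (ν : Stage7Numerics) (hε₀ : 0 < ν.ε₀) :
    gaugeAct v (1 : GaugeField (F.P K) k (SU N)) ∈ domAltOfRecord F N ν K k := by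
  rw [mem_domAltOfRecord_iff]
  intro p
  rw [flat_gaugeAct_one v p, GaugeGroup.dist1_one]
  exact hε₀

/-! ## §4. At the runs of record: the standing-range guard `k ≤ m + K` is automatic for `k ≤ P.K` (`(F.P K).K = K`, `(F.P K).m = F.m ≥ 1`) -/

/-- For a run `P` and a step `k ≤ P.K` the guard `k ≤ (F.P P.K).m + (F.P P.K).K` of FILE 1 ∕ §2–§3 holds. [cite: Balaban1987RG1, (0.1) p.251 (bookkeeping)] -/
theorem le_m_add_K_of_le (P : B12.RunParams) {k : ℕ} (hk : k ≤ P.K) : k ≤ (F.P P.K).m + (F.P P.K).K := by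
  rw [T4Family.P_m, T4Family.P_K]
  have := F.hm
  omega

/-- ★★ **THE DOOR's `h07sol ∕ h07uniq` AND `hreg8` AT THE TRIVIAL DATUM OF EVERY RUN AND STEP** (`k ≤ P.K`, radii `εbg, εreg > 0` arbitrary — e.g. the V18∕V19 witness's
`εbg = 1`, `εreg = a₀`): existence ∧ uniqueness at `V = 1`, uniqueness at the averaged minimisers, and `U_k … εbg 1 ∈ bgReg … εreg`. [cite: Balaban1985Variational, Thm 1 p.279] -/
theorem doorBinders_one_run (P : B12.RunParams) {k : ℕ} (hk : k ≤ P.K) {εbg εreg : ℝ} (hεbg : 0 < εbg) (hεreg : 0 < εreg) :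
    (UkExists F N P.K k εbg (1 : GaugeField (F.P P.K) k (SU N)) ∧ UniqueUkOrbit F N P.K k εbg (1 : GaugeField (F.P P.K) k (SU N))) ∧
      (∀ i < k, UniqueUkOrbit F N P.K (i + 1) εbg (Averaging.iter (avOfRecord F N P.K) (i + 1) (Uk F N P.K k εbg (1 : GaugeField (F.P P.K) k (SU N))))) ∧
      Uk F N P.K k εbg (1 : GaugeField (F.P P.K) k (SU N)) ∈ bgReg F N P.K k εreg :=
  ⟨h11_one (le_m_add_K_of_le (F := F) P hk) hεbg, huniq_one (le_m_add_K_of_le (F := F) P hk) hεbg, Uk_one_mem_bgReg k hεbg k hεreg⟩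

/-- The same at every PURE-GAUGE datum `1^{v}` of every run and step `k ≤ P.K`. [cite: Balaban1985Variational, Thm 1 p.279] -/
theorem doorBinders_gaugeAct_one_run (P : B12.RunParams) {k : ℕ} (hk : k ≤ P.K) {εbg εreg : ℝ} (hεbg : 0 < εbg) (hεreg : 0 < εreg)
    (v : GaugeTransf (F.P P.K) k (SU N)) :
    (UkExists F N P.K k εbg (gaugeAct v (1 : GaugeField (F.P P.K) k (SU N))) ∧ UniqueUkOrbit F N P.K k εbg (gaugeAct v (1 : GaugeField (F.P P.K) k (SU N)))) ∧
      (∀ i < k, UniqueUkOrbit F N P.K (i + 1) εbg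
        (Averaging.iter (avOfRecord F N P.K) (i + 1) (Uk F N P.K k εbg (gaugeAct v (1 : GaugeField (F.P P.K) k (SU N)))))) ∧
      Uk F N P.K k εbg (gaugeAct v (1 : GaugeField (F.P P.K) k (SU N))) ∈ bgReg F N P.K k εreg :=
  ⟨h11_gaugeAct_one (le_m_add_K_of_le (F := F) P hk) hεbg v, huniq_gaugeAct_one (le_m_add_K_of_le (F := F) P hk) hεbg v,
    Uk_gaugeAct_one_mem_bgReg (le_m_add_K_of_le (F := F) P hk) hεbg v k hεreg⟩

end Summit.QuantumFields.YangMills.BalabanUVNodes.N09FlatSectorData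

end
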